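import Summits.BirchSwinnertonDyer.Uniform.U2.RingClassNoTwoTorsion
import Summits.BirchSwinnertonDyer.Rank1Residual.X11b.RingClassFieldNoTorsion
import Literature.NumberTheory.EllipticCurves.TwoAdicImageSurjectivityModTwoProofs
import Literature.NumberTheory.QuadraticFields.HeegnerCondition
import HarnessLib

/-!
# Route `KolyvaginRankRigidityAtTwo`, cruxes V1′ (24622) / V2♭ (24623): Gross's Lemma 4.3 and the
# admissibility input `hA` of Kolyvagin's classes AT `p = 2`, on the route's habitat

Kolyvagin's classes `c_M(n) = d.kolyvaginClass Nat.prime_two M` of the tree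
(`HeegnerPointsOfConductor`) are McCallum's cocycle classes of `P(n)` relative to
`A = E(K[n]) ⊆ E(K̄)`, and are the junk value `0` unless `A` is ADMISSIBLE for `2^M`
(`KolyvaginCocycle.IsAdmissible`: `Γ_K`-stable, no `2^M`-torsion) — McCallum 1991 §4 (5)
*"`E` has no `K_n`-rational `p`-torsion"*, Gross 1991 Lemma 4.3, whose printed proof needs `p` odd
("`GL₂(ℤ/pℤ)`, `p > 2`, is not a quotient of a group of dihedral type"). AT `p = 2` on the habitat of
the route (`ρ̄_{E,2}` onto, `K` imaginary quadratic with ODD `d_K` and the Heegner hypothesis for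
`N_E`) the replacement is the tree THEOREM `Uniform.U2.RingClass.forall_two_nsmul_eq_zero_of_heegner`
(a `2`-torsion point over the generalised-dihedral `K[n]/ℚ` would put `√Δ_E` in `K ∖ ℚ`, i.e.
`Δ_E ∈ d_K ℚ²`, impossible under the Heegner hypothesis with `d_K` odd). This file packages it:

* `torsionBy_two_pow_ringClassField_eq_bot_of_heegner` — `E(K[n])[2^M] = 0` for every `n ≥ 1`, `M`;
* `isAdmissible_pointsSubgroup_two_of_heegner` — for every concrete Kolyvagin–Heegner datum `d` at a
  level `n ≥ 1` and every `M`, `E(K[n]) ⊆ E(K̄)` is `IsAdmissible Γ_K · 2^M` (`Γ_K`-stability is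
  x11b3's `RingClassNoTorsion.smul_toGeomPoints_eq`, Gross (4.2)).

HONEST FRAMING: theorems only (no definition, no named fact, no sorry); a shared input of the stubs
of V1′/V2♭, closing nothing by itself; BSD is not proved by any of this.
-/

set_option autoImplicit false
-- the Theorems namespace of this sub repeats the summit name by design (D-0017 nested layout)
set_option linter.dupNamespace false

noncomputable section

open scoped Classical

open WeierstrassCurve Field Literature.NumberTheory.EllipticCurves
  Literature.NumberTheory.EllipticCurves.ModularForms

namespace Summit.BirchSwinnertonDyer.BirchSwinnertonDyer.Theorems.KolyvaginAtTwo

-- `K : Type`: the tree's ring-class class field theory is universe `0`.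
variable {K : Type} [Field K] [NumberField K]

/-- **Gross's Lemma 4.3 at `p = 2` on the habitat: `E(K[n])[2^M] = 0`.** For `W/ℚ` globally
minimal elliptic with `ρ̄_{E,2}` onto, `K` imaginary quadratic with odd `d_K` satisfying the Heegner
hypothesis for `N_E`, every `n ≥ 1` and every `M`: the ring class field `K[n]` carries no
`2^M`-torsion of `E` (U2's `forall_two_nsmul_eq_zero_of_heegner` — `E(ℚ)[2] = 0` from
Dokchitser–Dokchitser (1), `d_K ≡ 1 (mod 4)` from Stickelberger — then McCallum's induction
`torsionBy_pow_eq_bot`). [cite: GrossLMS1991, Lemma 4.3] [cite: McCallumLMS1991, §4 (5)] -/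
theorem torsionBy_two_pow_ringClassField_eq_bot_of_heegner (W : WeierstrassCurve ℚ) [W.IsElliptic]
    [W.IsGloballyMinimal] (hs : W.HasSurjectiveModNGaloisRep 2) (hK : IsImaginaryQuadratic K)
    (ι : K →+* ℂ) (hodd : Odd (NumberField.discr K))
    (hH : SatisfiesHeegnerHypothesis (W.conductorNorm ℤ) K) {n : ℕ} (hn : n ≠ 0) (M : ℕ) :
    AddSubgroup.torsionBy (W.baseChange (ringClassField K ι n)).toAffine.Point ((2 ^ M : ℕ) : ℤ) = ⊥ := by
  haveI := (finiteDimensional_and_isGalois_ringClassField hK ι hn).1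
  haveI : NumberField (ringClassField K ι n) := NumberField.of_module_finite K _
  have hD4 : NumberField.discr K % 4 = 1 := by
    rcases Literature.NumberTheory.QuadraticFields.Quadratic.discr_emod_four (K := K) hK.1 with h | h
    · exact absurd h (by have := Int.odd_iff.mp hodd; omega)
    · exact h
  -- (`convert`: computable vs classical `DecidableEq ℚ` inside the group law of `E(ℚ)`)
  have hT : ∀ P : W.toAffine.Point, 2 • P = 0 → P = 0 := fun P hP ↦
    Literature.NumberTheory.EllipticCurves.DokchitserDokchitser2012.forall_two_nsmul_of_hasSurjectiveModNGaloisRep_two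
      W two_ne_zero hs P (by convert hP)
  refine torsionBy_pow_eq_bot (p := 2) ?_ M
  rw [eq_bot_iff]
  intro Q hQ
  rw [AddSubgroup.mem_bot]
  have h2 : (2 : ℕ) • Q = 0 := by
    have := AddSubgroup.torsionBy.nsmul_iff.mp hQ
    simpa using this
  exact Summit.BirchSwinnertonDyer.Uniform.U2.RingClass.forall_two_nsmul_eq_zero_of_heegner
    W hK ι hD4 hH hT hn Q h2

/-- **No `2^M`-torsion in `E(K[n])`, element form**: `2^M • R = 0 ⇒ R = 0`.
[cite: McCallumLMS1991, §4 (5)] -/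
theorem eq_zero_of_zsmul_two_pow_eq_zero_of_heegner (W : WeierstrassCurve ℚ) [W.IsElliptic]
    [W.IsGloballyMinimal] (hs : W.HasSurjectiveModNGaloisRep 2) (hK : IsImaginaryQuadratic K)
    (ι : K →+* ℂ) (hodd : Odd (NumberField.discr K))
    (hH : SatisfiesHeegnerHypothesis (W.conductorNorm ℤ) K) {n : ℕ} (hn : n ≠ 0) (M : ℕ)
    (R : (W.baseChange (ringClassField K ι n)).toAffine.Point) (hR : ((2 ^ M : ℕ) : ℤ) • R = 0) :
    R = 0 := by
  have h : R ∈ AddSubgroup.torsionBy (W.baseChange (ringClassField K ι n)).toAffine.Point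
      ((2 ^ M : ℕ) : ℤ) := (Submodule.mem_torsionBy_iff ((2 ^ M : ℕ) : ℤ) R).mpr hR
  rwa [torsionBy_two_pow_ringClassField_eq_bot_of_heegner W hs hK ι hodd hH hn M,
    AddSubgroup.mem_bot] at h

section KolyvaginHeegnerData

variable {W : WeierstrassCurve ℚ} [NeZero (W.conductorNorm ℤ)]
  {Dt : ModularParametrizationData W (W.conductorNorm ℤ)} {β : ℤ} {ι : K →+* ℂ} {n : ℕ}

/-- **The `hA` input of Kolyvagin's classes AT `p = 2` on the habitat** (McCallum 1991 §4 (5),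
Gross 1991 Lemma 4.3 and (4.2)): for `W/ℚ` globally minimal elliptic with `ρ̄_{E,2}` onto, `K`
imaginary quadratic with odd `d_K` and the Heegner hypothesis for `N_E`, a concrete Kolyvagin–Heegner
datum `d` at level `n ≥ 1` and any `M`, the subgroup `d.pointsSubgroup = E(K[n]) ⊆ E(K̄)` is
`Γ_K`-stable (x11b3's `RingClassNoTorsion.smul_toGeomPoints_eq`) and `2^M`-torsion-free, i.e.
`KolyvaginCocycle.IsAdmissible Γ_K d.pointsSubgroup 2^M`.
[cite: McCallumLMS1991, §4 (5)] [cite: GrossLMS1991, Lemma 4.3 and (4.2)] -/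
theorem isAdmissible_pointsSubgroup_two_of_heegner [W.IsElliptic] [W.IsGloballyMinimal]
    (d : KolyvaginHeegnerData Dt β ι n) (hs : W.HasSurjectiveModNGaloisRep 2)
    (hK : IsImaginaryQuadratic K) (hodd : Odd (NumberField.discr K))
    (hH : SatisfiesHeegnerHypothesis (W.conductorNorm ℤ) K) (hn : n ≠ 0) (M : ℕ) :
    KolyvaginCocycle.IsAdmissible (absoluteGaloisGroup K) d.pointsSubgroup ((2 ^ M : ℕ) : ℤ) where
  smul_mem g := by
    rintro _ ⟨P, rfl⟩
    exact ⟨_, (Summit.BirchSwinnertonDyer.Rank1Residual.X11b.RingClassNoTorsion.smul_toGeomPoints_eq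
      d hK hn g P).symm⟩
  eq_zero_of_zsmul := by
    rintro _ ⟨P, rfl⟩ hP
    rw [← map_zsmul] at hP
    have hP0 : ((2 ^ M : ℕ) : ℤ) • P = 0 :=
      (Affine.Point.map_injective (W' := W) d.emb.toRatAlgHom) (by rw [map_zero]; exact hP)
    rw [eq_zero_of_zsmul_two_pow_eq_zero_of_heegner W hs hK ι hodd hH hn M P hP0, map_zero]

end KolyvaginHeegnerData

end Summit.BirchSwinnertonDyer.BirchSwinnertonDyer.Theorems.KolyvaginAtTwo

end
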